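import Mathlib
import Summits.Ventures.PercRepro2.Defs
import Summits.Ventures.PercRepro2.Independence
import Summits.Ventures.PercRepro2.Graph
import Summits.Ventures.PercRepro2.Induced
import Summits.Ventures.PercRepro2.HullDefs
import Summits.Ventures.PercRepro2.HullFlip

/-!
# Theorems A and B of the hull form of (BASE) (blind cell PercRepro2, typer-1; lead g10
`LEAD-PROOFSHAPES.md` ADDENDUM 24 (4), ask 2026-08-23T06:35:39Z)

* `Good ζ`: `o` lies on a side of the hull of `l` and its piece is non-critical (for its colour);
  `flipO ζ` = the flip of the piece of `o`.
* **`sum_sideSign_mul_nonneg`** (the pairing argument): for any `φ ≥ 0` that can only drop when the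
  non-critical red piece of `o` is flipped, `Σ_ζ 1[Good ζ] · s_{o,l}(ζ) · φ(ζ) ≥ 0` — the flip is an
  involution of `{Good}` exchanging the sides.
* **THEOREM A** (`thmA_conn`, `thmA_conn_out`): the non-critical part of (BASE) is nonnegative,
  `Σ_{ζ : h ∉ H_l, P_o(ζ) non-critical} s_{o,l} · 1[h ↔_B b] ≥ 0`, and the same with `1[v ↔_B w]`
  for `v, w ∉ H_l` (the (HULL-OUT) form).
* **THEOREM B** (`thmB_conn`, `thmB_conn_out`): on `{core = {l}}` every piece is non-critical, so
  `Σ_{ζ : C_R(l) ∩ C_B(l) = {l}, h ∉ H_l} s_{o,l} · 1[h ↔_B b] ≥ 0` (and the (HULL-OUT) form).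
-/

namespace Summit.Ventures.PercRepro2

namespace Hull

open scoped Classical

variable {V : Type*} {E : Type*}

/-- `o` lies on a side of the hull and its piece is non-critical for its own colour. -/
def Good (ends : E → Sym2 V) (ζ : Config E) (l o : V) : Prop :=
  (o ∈ rside ends ζ l ∧ NonCritRed ends ζ l (piece ends ζ l o)) ∨
    (o ∈ bside ends ζ l ∧ NonCritRed ends (blue ζ) l (piece ends ζ l o))

/-- The flip of the piece of `o`. -/
noncomputable def flipO (ends : E → Sym2 V) (ζ : Config E) (l o : V) : Config E :=
  flip ends (piece ends ζ l o) ζ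

variable {ends : E → Sym2 V} {ζ : Config E} {l o : V}

/-! ## The flip of the piece of `o` -/

/-- `flipO` of the blue colouring is the blue colouring of `flipO`. -/
lemma flipO_blue : flipO ends (blue ζ) l o = blue (flipO ends ζ l o) := by
  unfold flipO
  rw [piece_blue, blue_flip]

/-- Red case: after the flip `o` is on the blue side, its piece is unchanged and non-critical. -/
lemma flipO_red (hR : o ∈ rside ends ζ l) (hnc : NonCritRed ends ζ l (piece ends ζ l o)) :
    o ∈ bside ends (flipO ends ζ l o) l ∧ piece ends (flipO ends ζ l o) l o = piece ends ζ l o ∧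
      NonCritRed ends (blue (flipO ends ζ l o)) l (piece ends ζ l o) ∧
      hull ends (flipO ends ζ l o) l = hull ends ζ l ∧
      core ends (flipO ends ζ l o) l = core ends ζ l := by
  have hP := isRedPiece_piece hR
  refine ⟨?_, piece_flip hP hnc o, nonCritRed_blue_flip hP hnc, hull_flip hP hnc, core_flip hP hnc⟩
  unfold flipO
  rw [bside_flip hP hnc]
  exact Or.inr (mem_piece_self ζ l o)

/-- Blue case (by colour symmetry): after the flip `o` is on the red side, its piece is unchanged
and non-critical. -/
lemma flipO_blue_case (hB : o ∈ bside ends ζ l)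
    (hnc : NonCritRed ends (blue ζ) l (piece ends ζ l o)) :
    o ∈ rside ends (flipO ends ζ l o) l ∧ piece ends (flipO ends ζ l o) l o = piece ends ζ l o ∧
      NonCritRed ends (flipO ends ζ l o) l (piece ends ζ l o) ∧
      hull ends (flipO ends ζ l o) l = hull ends ζ l ∧
      core ends (flipO ends ζ l o) l = core ends ζ l := by
  have hR : o ∈ rside ends (blue ζ) l := by rw [rside_blue]; exact hB
  have hnc' : NonCritRed ends (blue ζ) l (piece ends (blue ζ) l o) := by rw [piece_blue]; exact hnc
  obtain ⟨h1, h2, h3, h4, h5⟩ := flipO_red hR hnc'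
  rw [flipO_blue, bside_blue] at h1
  rw [flipO_blue, piece_blue, piece_blue] at h2
  rw [flipO_blue, blue_blue, piece_blue] at h3
  rw [flipO_blue, hull_blue, hull_blue] at h4
  rw [flipO_blue, core_blue, core_blue] at h5
  exact ⟨h1, h2, h3, h4, h5⟩

/-- The flip of the piece of `o` is an involution on `{Good}`. -/
lemma flipO_flipO (hg : Good ends ζ l o) : flipO ends (flipO ends ζ l o) l o = ζ := by
  have hp : piece ends (flipO ends ζ l o) l o = piece ends ζ l o := by
    rcases hg with ⟨hR, hnc⟩ | ⟨hB, hnc⟩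
    · exact (flipO_red hR hnc).2.1
    · exact (flipO_blue_case hB hnc).2.1
  show flip ends (piece ends (flipO ends ζ l o) l o) (flipO ends ζ l o) = ζ
  rw [hp]
  exact flip_flip _ _

/-- The flip maps `{Good}` to itself, exchanging the sides. -/
lemma good_flipO (hg : Good ends ζ l o) : Good ends (flipO ends ζ l o) l o := by
  rcases hg with ⟨hR, hnc⟩ | ⟨hB, hnc⟩
  · obtain ⟨h1, h2, h3, -⟩ := flipO_red hR hnc
    exact Or.inr ⟨h1, by rw [h2]; exact h3⟩
  · obtain ⟨h1, h2, h3, -⟩ := flipO_blue_case hB hnc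
    exact Or.inl ⟨h1, by rw [h2]; exact h3⟩

/-- The hull is preserved on `{Good}`. -/
lemma hull_flipO (hg : Good ends ζ l o) : hull ends (flipO ends ζ l o) l = hull ends ζ l := by
  rcases hg with ⟨hR, hnc⟩ | ⟨hB, hnc⟩
  · exact (flipO_red hR hnc).2.2.2.1
  · exact (flipO_blue_case hB hnc).2.2.2.1

/-- The core is preserved on `{Good}`. -/
lemma core_flipO (hg : Good ends ζ l o) : core ends (flipO ends ζ l o) l = core ends ζ l := by
  rcases hg with ⟨hR, hnc⟩ | ⟨hB, hnc⟩
  · exact (flipO_red hR hnc).2.2.2.2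
  · exact (flipO_blue_case hB hnc).2.2.2.2

/-! ## Theorem B's hypothesis: the core `{l}` -/

/-- When the core is `{l}`, every set is non-critical. -/
lemma nonCritRed_of_core_eq (hK : core ends ζ l = {l}) (P : Set V) : NonCritRed ends ζ l P := by
  intro k hk
  rw [hK, Set.mem_singleton_iff] at hk
  subst hk
  exact conn_refl _ _ _

/-- On `{core = {l}}`, `Good` is just "`o` lies on a side". -/
lemma good_iff_of_core_eq (hK : core ends ζ l = {l}) :
    Good ends ζ l o ↔ o ∈ rside ends ζ l ∨ o ∈ bside ends ζ l := by
  constructor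
  · rintro (h | h)
    · exact Or.inl h.1
    · exact Or.inr h.1
  · rintro (h | h)
    · exact Or.inl ⟨h, nonCritRed_of_core_eq hK _⟩
    · exact Or.inr ⟨h, nonCritRed_of_core_eq (ζ := blue ζ) (by rw [core_blue]; exact hK) _⟩

/-! ## The side sign on the two halves -/

section Sign

variable {R : Type*} [Ring R]

/-- The side sign on the red side. -/
lemma sideSign_eq_one (hR : o ∈ rside ends ζ l) : sideSign R ends ζ l o = 1 := by
  unfold sideSign
  rw [if_pos hR, if_neg (fun hB => rside_disjoint_bside ζ l o hR hB), sub_zero]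

/-- The side sign on the blue side. -/
lemma sideSign_eq_neg_one (hB : o ∈ bside ends ζ l) : sideSign R ends ζ l o = -1 := by
  unfold sideSign
  rw [if_pos hB, if_neg (fun hR => rside_disjoint_bside ζ l o hR hB), zero_sub]

/-- The side sign off the sides. -/
lemma sideSign_eq_zero (hR : o ∉ rside ends ζ l) (hB : o ∉ bside ends ζ l) :
    sideSign R ends ζ l o = 0 := by
  unfold sideSign
  rw [if_neg hR, if_neg hB, sub_zero]

end Sign

/-! ## The indicators of Theorem A -/

section Indicators

variable {R : Type*} [Field R] [LinearOrder R] [IsStrictOrderedRing R]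

/-- The indicator `1[h ∉ H_l] · 1[h ↔_B b]`. -/
noncomputable def outConn (R : Type*) [Ring R] (ends : E → Sym2 V) (l h b : V) (ζ : Config E) :
    R :=
  (if h ∉ hull ends ζ l then 1 else 0) * (if Conn ends (blue ζ) h b then 1 else 0)

/-- `outConn` is nonnegative. -/
lemma outConn_nonneg (ends : E → Sym2 V) (l h b : V) (ζ : Config E) :
    0 ≤ outConn R ends l h b ζ := by
  unfold outConn
  split_ifs <;> norm_num

/-- `outConn` can only drop under the flip of the non-critical red piece of `o`. -/
lemma outConn_flipO_le (h b : V) (hR : o ∈ rside ends ζ l)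
    (hnc : NonCritRed ends ζ l (piece ends ζ l o)) :
    outConn R ends l h b (flipO ends ζ l o) ≤ outConn R ends l h b ζ := by
  unfold outConn
  rw [(flipO_red hR hnc).2.2.2.1]
  by_cases hh : h ∉ hull ends ζ l
  · rw [if_pos hh, one_mul, one_mul]
    by_cases hc : Conn ends (blue ζ) h b
    · rw [if_pos hc]
      split_ifs <;> norm_num
    · by_cases hc' : Conn ends (blue (flipO ends ζ l o)) h b
      · exact absurd (conn_blue_of_conn_blue_flip (isRedPiece_piece hR) hh hc') hc
      · rw [if_neg hc, if_neg hc']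
  · rw [if_neg hh, zero_mul, zero_mul]

/-- The indicator `1[v ∉ H_l] · 1[w ∉ H_l] · 1[v ↔_B w]`. -/
noncomputable def outConn₂ (R : Type*) [Ring R] (ends : E → Sym2 V) (l v w : V) (ζ : Config E) :
    R :=
  (if w ∉ hull ends ζ l then 1 else 0) * outConn R ends l v w ζ

/-- `outConn₂` is nonnegative. -/
lemma outConn₂_nonneg (ends : E → Sym2 V) (l v w : V) (ζ : Config E) :
    0 ≤ outConn₂ R ends l v w ζ := by
  unfold outConn₂
  exact mul_nonneg (by split_ifs <;> norm_num) (outConn_nonneg ends l v w ζ)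

/-- `outConn₂` can only drop under the flip of the non-critical red piece of `o`. -/
lemma outConn₂_flipO_le (v w : V) (hR : o ∈ rside ends ζ l)
    (hnc : NonCritRed ends ζ l (piece ends ζ l o)) :
    outConn₂ R ends l v w (flipO ends ζ l o) ≤ outConn₂ R ends l v w ζ := by
  unfold outConn₂
  rw [(flipO_red hR hnc).2.2.2.1]
  exact mul_le_mul_of_nonneg_left (outConn_flipO_le v w hR hnc) (by split_ifs <;> norm_num)

end Indicators

/-! ## The pairing argument -/

section Sums

variable [Fintype E] [DecidableEq E] {R : Type*} [Field R] [LinearOrder R] [IsStrictOrderedRing R]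

/-- **The pairing argument** (ADDENDUM 24 (4)(a)): for `φ` that can only drop under the flip of
the non-critical red piece of `o`, `Σ_ζ 1[Good ζ] · s_{o,l}(ζ) · φ(ζ) ≥ 0`. -/
theorem sum_sideSign_mul_nonneg (ends : E → Sym2 V) (l o : V) (φ : Config E → R)
    (hφ : ∀ ζ, o ∈ rside ends ζ l → NonCritRed ends ζ l (piece ends ζ l o) →
      φ (flipO ends ζ l o) ≤ φ ζ) :
    0 ≤ ∑ ζ : Config E, if Good ends ζ l o then sideSign R ends ζ l o * φ ζ else 0 := by
  have hdisj : Disjoint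
      (Finset.univ.filter fun ζ : Config E =>
        o ∈ rside ends ζ l ∧ NonCritRed ends ζ l (piece ends ζ l o))
      (Finset.univ.filter fun ζ : Config E =>
        o ∈ bside ends ζ l ∧ NonCritRed ends (blue ζ) l (piece ends ζ l o)) :=
    Finset.disjoint_filter.2 fun ζ _ h₁ h₂ => rside_disjoint_bside ζ l o h₁.1 h₂.1
  have hfilter : (Finset.univ.filter fun ζ : Config E => Good ends ζ l o) =
      (Finset.univ.filter fun ζ : Config E =>
        o ∈ rside ends ζ l ∧ NonCritRed ends ζ l (piece ends ζ l o)) ∪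
      (Finset.univ.filter fun ζ : Config E =>
        o ∈ bside ends ζ l ∧ NonCritRed ends (blue ζ) l (piece ends ζ l o)) := by
    ext ζ
    simp only [Finset.mem_filter, Finset.mem_univ, true_and, Finset.mem_union, Good]
  have hsum : (∑ ζ : Config E, if Good ends ζ l o then sideSign R ends ζ l o * φ ζ else 0) =
      (∑ ζ ∈ Finset.univ.filter (fun ζ : Config E =>
        o ∈ rside ends ζ l ∧ NonCritRed ends ζ l (piece ends ζ l o)), φ ζ) -
      ∑ ζ ∈ Finset.univ.filter (fun ζ : Config E =>
        o ∈ bside ends ζ l ∧ NonCritRed ends (blue ζ) l (piece ends ζ l o)), φ ζ := by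
    rw [← Finset.sum_filter, hfilter, Finset.sum_union hdisj, sub_eq_add_neg,
      ← Finset.sum_neg_distrib]
    congr 1
    · refine Finset.sum_congr rfl fun ζ hζ => ?_
      rw [sideSign_eq_one (Finset.mem_filter.1 hζ).2.1, one_mul]
    · refine Finset.sum_congr rfl fun ζ hζ => ?_
      rw [sideSign_eq_neg_one (Finset.mem_filter.1 hζ).2.1, neg_one_mul]
  have hbij : (∑ ζ ∈ Finset.univ.filter (fun ζ : Config E =>
        o ∈ rside ends ζ l ∧ NonCritRed ends ζ l (piece ends ζ l o)), φ (flipO ends ζ l o)) =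
      ∑ ζ ∈ Finset.univ.filter (fun ζ : Config E =>
        o ∈ bside ends ζ l ∧ NonCritRed ends (blue ζ) l (piece ends ζ l o)), φ ζ := by
    refine Finset.sum_nbij' (fun ζ => flipO ends ζ l o) (fun ζ => flipO ends ζ l o) ?_ ?_ ?_ ?_ ?_
    · intro ζ hζ
      have hg : Good ends ζ l o := Or.inl (Finset.mem_filter.1 hζ).2
      rcases good_flipO hg with h | h
      · exact absurd h.1 fun hR => rside_disjoint_bside _ _ _ hR (flipO_red
          (Finset.mem_filter.1 hζ).2.1 (Finset.mem_filter.1 hζ).2.2).1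
      · exact Finset.mem_filter.2 ⟨Finset.mem_univ _, h⟩
    · intro ζ hζ
      have hg : Good ends ζ l o := Or.inr (Finset.mem_filter.1 hζ).2
      rcases good_flipO hg with h | h
      · exact Finset.mem_filter.2 ⟨Finset.mem_univ _, h⟩
      · exact absurd h.1 fun hB => rside_disjoint_bside _ _ _ (flipO_blue_case
          (Finset.mem_filter.1 hζ).2.1 (Finset.mem_filter.1 hζ).2.2).1 hB
    · intro ζ hζ
      exact flipO_flipO (Or.inl (Finset.mem_filter.1 hζ).2)
    · intro ζ hζ
      exact flipO_flipO (Or.inr (Finset.mem_filter.1 hζ).2)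
    · intro ζ _
      rfl
  rw [hsum, ← hbij, ← Finset.sum_sub_distrib]
  refine Finset.sum_nonneg fun ζ hζ => ?_
  have h := (Finset.mem_filter.1 hζ).2
  exact sub_nonneg.2 (hφ ζ h.1 h.2)

/-! ## Theorem A -/

/-- **THEOREM A** (ADDENDUM 24 (4)(a)): the non-critical part of (BASE) is nonnegative:
`Σ_{ζ : P_o(ζ) non-critical} s_{o,l}(ζ) · 1[h ∉ H_l] · 1[h ↔_B b] ≥ 0`. -/
theorem thmA_conn (ends : E → Sym2 V) (l o h b : V) :
    0 ≤ ∑ ζ : Config E,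
      if Good ends ζ l o then sideSign R ends ζ l o * outConn R ends l h b ζ else 0 :=
  sum_sideSign_mul_nonneg ends l o (outConn R ends l h b)
    fun _ hR hnc => outConn_flipO_le h b hR hnc

/-- **THEOREM A, (HULL-OUT) form**: `Σ_{ζ : P_o(ζ) non-critical} s_{o,l} · 1[v, w ∉ H_l] · 1[v ↔_B w] ≥ 0`. -/
theorem thmA_conn_out (ends : E → Sym2 V) (l o v w : V) :
    0 ≤ ∑ ζ : Config E,
      if Good ends ζ l o then sideSign R ends ζ l o * outConn₂ R ends l v w ζ else 0 :=
  sum_sideSign_mul_nonneg ends l o (outConn₂ R ends l v w)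
    fun _ hR hnc => outConn₂_flipO_le v w hR hnc

/-! ## Theorem B: the core `{l}` -/

/-- The pairing argument restricted to `{core = {l}}`. -/
theorem sum_sideSign_mul_nonneg_core (ends : E → Sym2 V) (l o : V) (φ : Config E → R)
    (hφ : ∀ ζ, o ∈ rside ends ζ l → NonCritRed ends ζ l (piece ends ζ l o) →
      φ (flipO ends ζ l o) ≤ φ ζ) :
    0 ≤ ∑ ζ : Config E, if core ends ζ l = {l} then sideSign R ends ζ l o * φ ζ else 0 := by
  have key := sum_sideSign_mul_nonneg (R := R) ends l o
    (fun ζ => (if core ends ζ l = {l} then 1 else 0) * φ ζ)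
    (fun ζ hR hnc => by
      rw [(flipO_red hR hnc).2.2.2.2]
      exact mul_le_mul_of_nonneg_left (hφ ζ hR hnc) (by split_ifs <;> norm_num))
  refine key.trans (le_of_eq (Finset.sum_congr rfl fun ζ _ => ?_))
  by_cases hK : core ends ζ l = {l}
  · rw [if_pos hK, if_pos hK, one_mul]
    by_cases hg : Good ends ζ l o
    · rw [if_pos hg]
    · rw [if_neg hg]
      rw [good_iff_of_core_eq hK, not_or] at hg
      rw [sideSign_eq_zero hg.1 hg.2, zero_mul]
  · rw [if_neg hK, if_neg hK, zero_mul, mul_zero, ite_self]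

/-- **THEOREM B** (ADDENDUM 24 (4)(a)): (BASE) holds on `{C_R(l) ∩ C_B(l) = {l}}`:
`Σ_{ζ : core = {l}} s_{o,l}(ζ) · 1[h ∉ H_l] · 1[h ↔_B b] ≥ 0`. -/
theorem thmB_conn (ends : E → Sym2 V) (l o h b : V) :
    0 ≤ ∑ ζ : Config E,
      if core ends ζ l = {l} then sideSign R ends ζ l o * outConn R ends l h b ζ else 0 :=
  sum_sideSign_mul_nonneg_core ends l o (outConn R ends l h b)
    fun _ hR hnc => outConn_flipO_le h b hR hnc

/-- **THEOREM B, (HULL-OUT) form**: `Σ_{ζ : core = {l}} s_{o,l} · 1[v, w ∉ H_l] · 1[v ↔_B w] ≥ 0`. -/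
theorem thmB_conn_out (ends : E → Sym2 V) (l o v w : V) :
    0 ≤ ∑ ζ : Config E,
      if core ends ζ l = {l} then sideSign R ends ζ l o * outConn₂ R ends l v w ζ else 0 :=
  sum_sideSign_mul_nonneg_core ends l o (outConn₂ R ends l v w)
    fun _ hR hnc => outConn₂_flipO_le v w hR hnc

end Sums

end Hull

end Summit.Ventures.PercRepro2
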